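import Literature.NumberTheory.Automorphic.UnitaryGroupFrameEmbedding
import Literature.NumberTheory.Automorphic.UnitaryGroupAdelicLineTorus
import Literature.LinearAlgebra.Matrix.HermitianCongruenceInertia
import HarnessLib

/-!
# The sub-forms `J₁`, `J₂` of a frame `ᵗσ(B)·(a • H)·B = J₁ ⊕ᶠ J₂`: hermitian, anisotropic, definite, signature

[Kudla1984, §1] / [BergeronMillsonMoeglin2016Balls] Part 2 §§1.1, 3.1: for an orthogonal decomposition `V = V₁ ⊕ V₂` of a
hermitian space the restricted forms inherit hermitian symmetry, anisotropy and definiteness, and at a place of signature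
`(n, 1)` with `V₂` definite the summand `V₁` has signature `(n₁, 1)` ([HornJohnson2013] Thm. 4.5.8, Sylvester).  In the
tree's frame currency (★ `formCongr`, ★ `UnitaryGroup.finSum`, ★ `UnitaryGroupFrameEmbedding`), under
`hB : formCongr σ B (a • H) = finSum N₁ N₂ J₁ J₂`:
* §1 **`isHermitian_subform_left/right`**: `ᵗσ(H) = H`, `σ` an involution, `σ a = a` ⇒ `ᵗσ(J₁) = J₁`, `ᵗσ(J₂) = J₂`;
* §2 **`anisotropic_subform_left`**: `H` anisotropic and `a ≠ 0` ⇒ `⟨x,x⟩_{J₁} = 0 → x = 0`;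
* §3 **`posDef_map_subform_left/right`**: at `τ : E →+* ℂ` with `τ ∘ σ = conj ∘ τ`, `(H.map τ).PosDef` and `τ a` a positive
  real ⇒ `(J₁.map τ).PosDef`, `(J₂.map τ).PosDef`;
* §4 determinants: `det (ᵗσ(B)·M·B) = σ(det B) · det M · det B` (with ★ `det_finSum`);
* §5 **signature `(1,1)` of the `2 × 2` block at a place of signature `(2,1)`**, over `ℂ`
  (`exists_frame_formCongr_eq_diagonal_one_neg_one`: determinant sign + the spectral theorem on the hermitian `2 × 2` block);
* §6 its `E`-rational form **`exists_frame_map_subform_left_eq_diagonal(_one)`** at `(N₁, N₂) = (2, 1)` — literally the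
  signature hypothesis `_hT : formCongr (starRingEnd ℂ) T⋆ (Jstar.map τ) = Matrix.diagonal ![1, -1]` of the cell's GS-3 text.

All proved; no definitions, no named facts.  Written for the cell `hodgecm-mathlib` (A-plan2 `GS-PROGRAMME.md` §9 A.12 §4 (G9),
«T1a sub-form lemmas»: the hypotheses GS-8 must discharge at the face from `V : HermSpace3` and F3's frame).
-/

set_option autoImplicit false

noncomputable section

namespace Literature.NumberTheory.Automorphic.UnitaryGroup

open _root_.Matrix
open scoped ComplexOrder ComplexConjugate

/-! ## §1 Hermitian symmetry of the sub-forms -/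

section Hermitian

variable {S : Type*} [CommRing S] (σ : S →+* S) {n : Type*} [Fintype n] [DecidableEq n]

/-- `ᵗσ(ᵗσ(B)·M·B) = ᵗσ(B)·ᵗσ(M)·B` for `σ` an involution: the frame transform of a `σ`-hermitian matrix is `σ`-hermitian.
[cite: Dieudonne1971GroupesClassiques, Chap. II §5] -/
theorem transpose_map_formCongr (hσ : ∀ x, σ (σ x) = x) (B : GL n S) (M : Matrix n n S) :
    ((formCongr σ B M).map σ)ᵀ = formCongr σ B ((M.map σ)ᵀ) := by
  have hBσσ : ((B : Matrix n n S).map σ).map σ = (B : Matrix n n S) := by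
    rw [Matrix.map_map]
    exact Matrix.map_id' _ |>.symm ▸ (by ext i j; simp [hσ])
  simp only [formCongr, Matrix.map_mul, Matrix.transpose_mul, Matrix.transpose_map, Matrix.transpose_transpose,
    hBσσ, Matrix.mul_assoc]

omit [Fintype n] [DecidableEq n] in
/-- `ᵗσ(a • H) = a • H` when `ᵗσ(H) = H` and `σ a = a`. [cite: Dieudonne1971GroupesClassiques, Chap. II §5] -/
theorem transpose_map_smul_of_transpose_map_eq {H : Matrix n n S} (hH : (H.map σ)ᵀ = H) {a : S} (ha : σ a = a) :
    ((a • H).map σ)ᵀ = a • H := by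
  ext i j
  have hij := congrFun (congrFun hH i) j
  rw [transpose_apply, map_apply] at hij
  rw [transpose_apply, map_apply, Matrix.smul_apply, Matrix.smul_apply, smul_eq_mul, smul_eq_mul, map_mul, ha, hij]

variable {N₁ N₂ : ℕ}

/-- The blocks of a `σ`-hermitian `J₁ ⊕ᶠ J₂` are `σ`-hermitian (left block). [cite: Kudla1984, §1] -/
theorem transpose_map_eq_of_finSum_left {J₁ : Matrix (Fin N₁) (Fin N₁) S} {J₂ : Matrix (Fin N₂) (Fin N₂) S}
    (h : ((finSum N₁ N₂ J₁ J₂).map σ)ᵀ = finSum N₁ N₂ J₁ J₂) : (J₁.map σ)ᵀ = J₁ := by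
  ext i j
  have hij := congrFun (congrFun h (Fin.castAdd N₂ i)) (Fin.castAdd N₂ j)
  rw [transpose_apply, map_apply, finSum_apply_castAdd_castAdd, finSum_apply_castAdd_castAdd] at hij
  rw [transpose_apply, map_apply]
  exact hij

/-- The blocks of a `σ`-hermitian `J₁ ⊕ᶠ J₂` are `σ`-hermitian (right block). [cite: Kudla1984, §1] -/
theorem transpose_map_eq_of_finSum_right {J₁ : Matrix (Fin N₁) (Fin N₁) S} {J₂ : Matrix (Fin N₂) (Fin N₂) S}
    (h : ((finSum N₁ N₂ J₁ J₂).map σ)ᵀ = finSum N₁ N₂ J₁ J₂) : (J₂.map σ)ᵀ = J₂ := by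
  ext i j
  have hij := congrFun (congrFun h (Fin.natAdd N₁ i)) (Fin.natAdd N₁ j)
  rw [transpose_apply, map_apply, finSum_apply_natAdd_natAdd, finSum_apply_natAdd_natAdd] at hij
  rw [transpose_apply, map_apply]
  exact hij

/-- **The sub-form `J₁` is `σ`-hermitian**: `ᵗσ(H) = H`, `σ ∘ σ = id`, `σ a = a` and `ᵗσ(B)·(a • H)·B = J₁ ⊕ᶠ J₂` give
`ᵗσ(J₁) = J₁`. [cite: Kudla1984, §1] [cite: BergeronMillsonMoeglin2016Balls, Part 2 §1.1] -/
theorem isHermitian_subform_left (hσ : ∀ x, σ (σ x) = x) {H : Matrix (Fin (N₁ + N₂)) (Fin (N₁ + N₂)) S}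
    (hH : (H.map σ)ᵀ = H) {a : S} (ha : σ a = a) {B : GL (Fin (N₁ + N₂)) S} {J₁ : Matrix (Fin N₁) (Fin N₁) S}
    {J₂ : Matrix (Fin N₂) (Fin N₂) S} (hB : formCongr σ B (a • H) = finSum N₁ N₂ J₁ J₂) : (J₁.map σ)ᵀ = J₁ := by
  apply transpose_map_eq_of_finSum_left σ (J₂ := J₂)
  rw [← hB, transpose_map_formCongr σ hσ, transpose_map_smul_of_transpose_map_eq σ hH ha]

/-- **The sub-form `J₂` is `σ`-hermitian** (same hypotheses). [cite: Kudla1984, §1]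
[cite: BergeronMillsonMoeglin2016Balls, Part 2 §1.1] -/
theorem isHermitian_subform_right (hσ : ∀ x, σ (σ x) = x) {H : Matrix (Fin (N₁ + N₂)) (Fin (N₁ + N₂)) S}
    (hH : (H.map σ)ᵀ = H) {a : S} (ha : σ a = a) {B : GL (Fin (N₁ + N₂)) S} {J₁ : Matrix (Fin N₁) (Fin N₁) S}
    {J₂ : Matrix (Fin N₂) (Fin N₂) S} (hB : formCongr σ B (a • H) = finSum N₁ N₂ J₁ J₂) : (J₂.map σ)ᵀ = J₂ := by
  apply transpose_map_eq_of_finSum_right σ (J₁ := J₁)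
  rw [← hB, transpose_map_formCongr σ hσ, transpose_map_smul_of_transpose_map_eq σ hH ha]

end Hermitian

/-! ## §2 Anisotropy of the sub-form `J₁` -/

section Anisotropic

variable {E : Type*} [Field E] (σ : E →+* E) {N₁ N₂ : ℕ}

/-- **The sub-form `J₁` is anisotropic when `H` is**: if `⟨v,v⟩_H = 0 → v = 0` on `E^{N₁+N₂}`, `a ≠ 0` and
`ᵗσ(B)·(a • H)·B = J₁ ⊕ᶠ J₂`, then `⟨x,x⟩_{J₁} = 0 → x = 0` (`a⟨B(x⊕0), B(x⊕0)⟩_H = ⟨x,x⟩_{J₁}` and `x ↦ B(x ⊕ 0)` is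
injective). [cite: Kudla1984, §1] [cite: BergeronMillsonMoeglin2016Balls, Part 2 §1.1] -/
theorem anisotropic_subform_left {H : Matrix (Fin (N₁ + N₂)) (Fin (N₁ + N₂)) E}
    (hanis : ∀ v : Fin (N₁ + N₂) → E, hermForm σ H v v = 0 → v = 0) {a : E} (ha : a ≠ 0) {B : GL (Fin (N₁ + N₂)) E}
    {J₁ : Matrix (Fin N₁) (Fin N₁) E} {J₂ : Matrix (Fin N₂) (Fin N₂) E}
    (hB : formCongr σ B (a • H) = finSum N₁ N₂ J₁ J₂) (x : Fin N₁ → E) (hx : hermForm σ J₁ x x = 0) : x = 0 := by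
  have h := mul_hermForm_frameEmb_zero_eq σ hB x x
  rw [hx, mul_eq_zero] at h
  have h0 : (B : Matrix (Fin (N₁ + N₂)) (Fin (N₁ + N₂)) E) *ᵥ Fin.append x (0 : Fin N₂ → E) = 0 :=
    hanis _ (h.resolve_left ha)
  have h1 : (B : Matrix (Fin (N₁ + N₂)) (Fin (N₁ + N₂)) E) *ᵥ Fin.append (0 : Fin N₁ → E) (0 : Fin N₂ → E) = 0 := by
    have : Fin.append (0 : Fin N₁ → E) (0 : Fin N₂ → E) = 0 := by
      funext k
      induction k using Fin.addCases with
      | left i => simp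
      | right j => simp
    rw [this, Matrix.mulVec_zero]
  exact frameEmb_injective (N₂ := N₂) B (h0.trans h1.symm)

end Anisotropic

/-! ## §3 Definiteness of the sub-forms at a definite place -/

section Definite

variable {E : Type*} [Field E] (σ : E →+* E) (τ : E →+* ℂ) {N₁ N₂ : ℕ}

/-- A `σ`-hermitian matrix has hermitian image under an embedding intertwining `σ` with complex conjugation.
[cite: BergeronMillsonMoeglin2016Balls, Part 2 §1.1] -/
theorem isHermitian_map_of_transpose_map_eq (hτ : ∀ x, τ (σ x) = starRingEnd ℂ (τ x)) {m : Type*}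
    {J : Matrix m m E} (hJ : (J.map σ)ᵀ = J) : (J.map τ).IsHermitian := by
  have h := Literature.LinearAlgebra.Matrix.map_transpose_map_eq_conjTranspose τ σ hτ J
  rw [hJ] at h
  exact h.symm

/-- `0 < c` in the complex order for a complex number with positive real part and zero imaginary part (plumbing). [folklore] -/
private theorem complex_pos_of_re_pos_im_zero {c : ℂ} (hc : 0 < c.re) (hc' : c.im = 0) : (0 : ℂ) < c :=
  Complex.lt_def.2 ⟨by simpa using hc, by simp [hc']⟩

/-- `x ⊕ y = 0` forces `x = 0` and `y = 0` (plumbing). [folklore] -/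
private theorem eq_zero_of_append_eq_zero {α : Type*} [Zero α] {x : Fin N₁ → α} {y : Fin N₂ → α}
    (h : Fin.append x y = 0) : x = 0 ∧ y = 0 := by
  refine ⟨funext fun i => ?_, funext fun j => ?_⟩
  · have := congrFun h (Fin.castAdd N₂ i)
    simpa only [Fin.append_left, Pi.zero_apply] using this
  · have := congrFun h (Fin.natAdd N₁ j)
    simpa only [Fin.append_right, Pi.zero_apply] using this

/-- The complex frame `B^τ` has injective `mulVec` (plumbing: it is the unit `GL.map τ B`). [folklore] -/
private theorem mulVec_map_injective (B : GL (Fin (N₁ + N₂)) E) :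
    Function.Injective ((B : Matrix (Fin (N₁ + N₂)) (Fin (N₁ + N₂)) E).map τ).mulVec :=
  Matrix.mulVec_injective_iff_isUnit.2 ⟨Matrix.GeneralLinearGroup.map τ B, rfl⟩

/-- **The sub-form `J₁` is positive definite at a definite place**: for `τ ∘ σ = conj ∘ τ`, `ᵗσ(J₁) = J₁`, `(H.map τ)` positive
definite, `τ a` a positive real and `ᵗσ(B)·(a • H)·B = J₁ ⊕ᶠ J₂`, the complex matrix `J₁^τ` is positive definite
(`τa · ⟨B^τ(z⊕0), B^τ(z⊕0)⟩_{H^τ} = ⟨z,z⟩_{J₁^τ}` for every complex `z`). [cite: Kudla1984, §1]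
[cite: BergeronMillsonMoeglin2016Balls, Part 2 §1.1] -/
theorem posDef_map_subform_left (hτ : ∀ x, τ (σ x) = starRingEnd ℂ (τ x)) {H : Matrix (Fin (N₁ + N₂)) (Fin (N₁ + N₂)) E}
    (hH : (H.map τ).PosDef) {a : E} (ha : 0 < (τ a).re) (ha' : (τ a).im = 0) {B : GL (Fin (N₁ + N₂)) E}
    {J₁ : Matrix (Fin N₁) (Fin N₁) E} {J₂ : Matrix (Fin N₂) (Fin N₂) E} (hJ₁ : (J₁.map σ)ᵀ = J₁)
    (hB : formCongr σ B (a • H) = finSum N₁ N₂ J₁ J₂) : (J₁.map τ).PosDef := by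
  refine Matrix.PosDef.of_dotProduct_mulVec_pos (isHermitian_map_of_transpose_map_eq σ τ hτ hJ₁) fun z hz => ?_
  have h := mul_hermForm_map_frameEmb_eq σ τ hτ hB z z (0 : Fin N₂ → ℂ) 0
  rw [hermForm_zero_right, add_zero] at h
  -- `⟨z,z⟩_{J₁^τ} = τa · ⟨w, w⟩_{H^τ}` with `w = B^τ(z ⊕ 0) ≠ 0`
  have hw : (B : Matrix (Fin (N₁ + N₂)) (Fin (N₁ + N₂)) E).map τ *ᵥ Fin.append z (0 : Fin N₂ → ℂ) ≠ 0 := fun h0 =>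
    hz (eq_zero_of_append_eq_zero (mulVec_map_injective τ B (h0.trans (Matrix.mulVec_zero _).symm))).1
  have hpos := hH.dotProduct_mulVec_pos hw
  change 0 < hermForm (starRingEnd ℂ) (J₁.map τ) z z
  rw [← h]
  exact mul_pos (complex_pos_of_re_pos_im_zero ha ha') hpos

/-- **The sub-form `J₂` is positive definite at a definite place** (same hypotheses, right block).
[cite: Kudla1984, §1] [cite: BergeronMillsonMoeglin2016Balls, Part 2 §1.1] -/
theorem posDef_map_subform_right (hτ : ∀ x, τ (σ x) = starRingEnd ℂ (τ x)) {H : Matrix (Fin (N₁ + N₂)) (Fin (N₁ + N₂)) E}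
    (hH : (H.map τ).PosDef) {a : E} (ha : 0 < (τ a).re) (ha' : (τ a).im = 0) {B : GL (Fin (N₁ + N₂)) E}
    {J₁ : Matrix (Fin N₁) (Fin N₁) E} {J₂ : Matrix (Fin N₂) (Fin N₂) E} (hJ₂ : (J₂.map σ)ᵀ = J₂)
    (hB : formCongr σ B (a • H) = finSum N₁ N₂ J₁ J₂) : (J₂.map τ).PosDef := by
  refine Matrix.PosDef.of_dotProduct_mulVec_pos (isHermitian_map_of_transpose_map_eq σ τ hτ hJ₂) fun z hz => ?_
  have h := mul_hermForm_map_frameEmb_eq σ τ hτ hB (0 : Fin N₁ → ℂ) 0 z z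
  rw [hermForm_zero_right, zero_add] at h
  have hw : (B : Matrix (Fin (N₁ + N₂)) (Fin (N₁ + N₂)) E).map τ *ᵥ Fin.append (0 : Fin N₁ → ℂ) z ≠ 0 := fun h0 =>
    hz (eq_zero_of_append_eq_zero (mulVec_map_injective τ B (h0.trans (Matrix.mulVec_zero _).symm))).2
  have hpos := hH.dotProduct_mulVec_pos hw
  change 0 < hermForm (starRingEnd ℂ) (J₂.map τ) z z
  rw [← h]
  exact mul_pos (complex_pos_of_re_pos_im_zero ha ha') hpos

end Definite

/-! ## §4 Determinants of frame equations -/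

section Det

variable {S : Type*} [CommRing S] {N₁ N₂ : ℕ}

/-- `det (M.map σ) = σ (det M)` for a ring hom `σ`. [folklore]-level; [cite: Dieudonne1971GroupesClassiques, Chap. II §5] -/
theorem det_map_ringHom {n : Type*} [Fintype n] [DecidableEq n] {S' : Type*} [CommRing S'] (σ : S →+* S')
    (M : Matrix n n S) : (M.map σ).det = σ M.det := by
  rw [RingHom.map_det, RingHom.mapMatrix_apply]

/-- **Determinant of a frame equation**: `det (ᵗσ(B)·M·B) = σ(det B) · det M · det B`.
[cite: Dieudonne1971GroupesClassiques, Chap. II §5] -/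
theorem det_formCongr {n : Type*} [Fintype n] [DecidableEq n] (σ : S →+* S) (B : GL n S) (M : Matrix n n S) :
    (formCongr σ B M).det = σ (B : Matrix n n S).det * M.det * (B : Matrix n n S).det := by
  simp only [formCongr, Matrix.det_mul, Matrix.det_transpose, det_map_ringHom]

end Det

/-! ## §5 Signature `(1,1)` of the `2 × 2` sub-form at a place of signature `(2,1)` -/

section Signature

/-- `conj z * z` is the real number `normSq z` (plumbing). [folklore] -/
private theorem conj_mul_self_eq (z : ℂ) : starRingEnd ℂ z * z = (Complex.normSq z : ℂ) :=
  Complex.normSq_eq_conj_mul_self.symm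

/-- **Reindex-and-rescale a diagonalising frame**: from `Uᴴ·J·U = diag(d)`, the frame `T = (U∘e)·diag(s)` whose columns are
the columns of `U` reordered along a permutation `e` and scaled by real factors `s` satisfies `Tᴴ·J·T = diag(s_k · d_{e k} · s_k)`
(the normalisation step of [HornJohnson2013] Thm. 4.5.7: every hermitian matrix is congruent to its inertia matrix).
[cite: HornJohnson2013, §4.5 Thm 4.5.7 and Thm 4.5.8] -/
theorem conjTranspose_mul_mul_submatrix_mul_diagonal {n : Type*} [Fintype n] [DecidableEq n]
    (J U : Matrix n n ℂ) {d : n → ℂ} (hU : Uᴴ * J * U = Matrix.diagonal d) (e : n ≃ n) (s : n → ℝ) :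
    (U.submatrix id e * Matrix.diagonal (fun k => (s k : ℂ)))ᴴ * J *
        (U.submatrix id e * Matrix.diagonal (fun k => (s k : ℂ))) =
      Matrix.diagonal (fun k => (s k : ℂ) * d (e k) * (s k : ℂ)) := by
  have hsub : (U.submatrix id e)ᴴ * J * U.submatrix id e = (Uᴴ * J * U).submatrix e e := by
    ext k l
    simp only [Matrix.mul_apply, Matrix.submatrix_apply, Matrix.conjTranspose_apply, id]
  have hdiag : (Matrix.diagonal (fun k => (s k : ℂ)))ᴴ = Matrix.diagonal (fun k => (s k : ℂ)) := by
    rw [Matrix.diagonal_conjTranspose]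
    congr 1
    funext k
    simp
  rw [Matrix.conjTranspose_mul, hdiag]
  calc Matrix.diagonal (fun k => (s k : ℂ)) * (U.submatrix id e)ᴴ * J * (U.submatrix id e * Matrix.diagonal fun k => (s k : ℂ))
      = Matrix.diagonal (fun k => (s k : ℂ)) * ((U.submatrix id e)ᴴ * J * U.submatrix id e) *
          Matrix.diagonal (fun k => (s k : ℂ)) := by simp only [Matrix.mul_assoc]
    _ = Matrix.diagonal (fun k => (s k : ℂ) * d (e k) * (s k : ℂ)) := by
          rw [hsub, hU, Matrix.submatrix_diagonal_equiv, Matrix.diagonal_mul_diagonal, Matrix.diagonal_mul_diagonal]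
          rfl

/-- **Signature `(1,1)` of the `2 × 2` block, over `ℂ`.**  Let `Hc ∈ M₃(ℂ)` carry a Sylvester frame of signature `(2,1)`
(`Tᴴ·Hc·T = diag(1,1,−1)`), let `c` be a positive real, and let `Bcᴴ·(c • Hc)·Bc = J₁c ⊕ᶠ J₂c` with `J₁c` hermitian `2 × 2` and
`J₂c₀₀` a positive real.  Then `J₁c` has a Sylvester frame of signature `(1,1)`: `∃ T⋆ ∈ GL₂(ℂ), T⋆ᴴ·J₁c·T⋆ = diag(1,−1)`
(determinants: `det J₁c · J₂c₀₀ = |det Bc|² c³ det Hc < 0`, so the two real eigenvalues of `J₁c` have opposite signs; rescale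
the unitary eigenframe). [cite: HornJohnson2013, §4.5 Thm 4.5.8 (Sylvester's law of inertia)]
[cite: BergeronMillsonMoeglin2016Balls, Part 2 §3.1] -/
theorem exists_frame_formCongr_eq_diagonal_one_neg_one {Hc : Matrix (Fin 3) (Fin 3) ℂ} {T Bc : GL (Fin 3) ℂ}
    (hT : formCongr (starRingEnd ℂ) T Hc = Matrix.diagonal ![1, 1, -1]) {c : ℂ} (hc : 0 < c.re) (hc' : c.im = 0)
    {J₁c : Matrix (Fin 2) (Fin 2) ℂ} {J₂c : Matrix (Fin 1) (Fin 1) ℂ} (hJ₁c : J₁c.IsHermitian)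
    (hJ₂c : 0 < (J₂c 0 0).re) (hJ₂c' : (J₂c 0 0).im = 0)
    (hBc : formCongr (starRingEnd ℂ) Bc (c • Hc) = finSum 2 1 J₁c J₂c) :
    ∃ Tstar : GL (Fin 2) ℂ, formCongr (starRingEnd ℂ) Tstar J₁c = Matrix.diagonal ![1, -1] := by
  set x := (T : Matrix (Fin 3) (Fin 3) ℂ).det with hx
  set y := (Bc : Matrix (Fin 3) (Fin 3) ℂ).det with hy
  have hx0 : x ≠ 0 := ((Matrix.isUnit_iff_isUnit_det _).1 (Units.isUnit T)).ne_zero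
  have hy0 : y ≠ 0 := ((Matrix.isUnit_iff_isUnit_det _).1 (Units.isUnit Bc)).ne_zero
  have hdT : starRingEnd ℂ x * Hc.det * x = -1 := by
    have h := congrArg Matrix.det hT
    rw [det_formCongr, Matrix.det_diagonal] at h
    rw [h]
    simp [Fin.prod_univ_three]
  have hdB : starRingEnd ℂ y * (c ^ 3 * Hc.det) * y = J₁c.det * J₂c 0 0 := by
    have h := congrArg Matrix.det hBc
    rw [det_formCongr, Matrix.det_smul, Fintype.card_fin, det_finSum, Matrix.det_fin_one] at h
    exact h
  have hnx : (0 : ℝ) < Complex.normSq x := Complex.normSq_pos.2 hx0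
  have hny : (0 : ℝ) < Complex.normSq y := Complex.normSq_pos.2 hy0
  have hn0 : (Complex.normSq x : ℂ) ≠ 0 := by exact_mod_cast hnx.ne'
  have hHc : Hc.det = ((-(Complex.normSq x)⁻¹ : ℝ) : ℂ) := by
    have h1 : (Complex.normSq x : ℂ) * Hc.det = -1 := by
      rw [Complex.normSq_eq_conj_mul_self]
      calc starRingEnd ℂ x * x * Hc.det = starRingEnd ℂ x * Hc.det * x := by ring
        _ = -1 := hdT
    have h2 : Hc.det = ((Complex.normSq x : ℂ))⁻¹ * ((Complex.normSq x : ℂ) * Hc.det) := by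
      rw [← mul_assoc, inv_mul_cancel₀ hn0, one_mul]
    rw [h2, h1]
    push_cast
    ring
  have hcoe : ∀ r : ℝ, (RCLike.ofReal r : ℂ) = (r : ℂ) := fun r => rfl
  have hdetJ : J₁c.det = (hJ₁c.eigenvalues 0 : ℂ) * (hJ₁c.eigenvalues 1 : ℂ) := by
    rw [hJ₁c.det_eq_prod_eigenvalues, Fin.prod_univ_two]
    exact rfl
  have hr : J₂c 0 0 = ((J₂c 0 0).re : ℂ) := Complex.ext (by simp) (by simp [hJ₂c'])
  have hγ : c = (c.re : ℂ) := Complex.ext (by simp) (by simp [hc'])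
  have hreal : Complex.normSq y * (c.re ^ 3 * (-(Complex.normSq x)⁻¹)) = hJ₁c.eigenvalues 0 * hJ₁c.eigenvalues 1 * (J₂c 0 0).re := by
    have h := hdB
    rw [hHc, hdetJ, hr, hγ] at h
    have h2 : starRingEnd ℂ y * (((c.re : ℂ)) ^ 3 * ((-(Complex.normSq x)⁻¹ : ℝ) : ℂ)) * y =
        (Complex.normSq y : ℂ) * (((c.re : ℂ)) ^ 3 * ((-(Complex.normSq x)⁻¹ : ℝ) : ℂ)) := by
      rw [Complex.normSq_eq_conj_mul_self]
      ring
    rw [h2] at h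
    exact_mod_cast h
  have hlhs : Complex.normSq y * (c.re ^ 3 * (-(Complex.normSq x)⁻¹)) < 0 :=
    mul_neg_of_pos_of_neg hny (mul_neg_of_pos_of_neg (pow_pos hc 3) (neg_neg_of_pos (inv_pos.2 hnx)))
  have hprod : hJ₁c.eigenvalues 0 * hJ₁c.eigenvalues 1 < 0 := by
    rw [hreal] at hlhs
    by_contra hge
    exact absurd hlhs (not_lt.2 (mul_nonneg (not_lt.1 hge) hJ₂c.le))
  have hU : (hJ₁c.eigenvectorUnitary : Matrix (Fin 2) (Fin 2) ℂ)ᴴ * J₁c *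
      (hJ₁c.eigenvectorUnitary : Matrix (Fin 2) (Fin 2) ℂ) = Matrix.diagonal (RCLike.ofReal ∘ hJ₁c.eigenvalues) := by
    have h := hJ₁c.conjStarAlgAut_star_eigenvectorUnitary
    rw [Unitary.conjStarAlgAut_star_apply] at h
    simpa only [Unitary.coe_star, Matrix.star_eq_conjTranspose] using h
  obtain ⟨perm, hp0, hp1⟩ : ∃ perm : Fin 2 ≃ Fin 2, 0 < hJ₁c.eigenvalues (perm 0) ∧ hJ₁c.eigenvalues (perm 1) < 0 := by
    rcases mul_neg_iff.1 hprod with ⟨h0, h1⟩ | ⟨h0, h1⟩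
    · exact ⟨Equiv.refl _, h0, h1⟩
    · exact ⟨Equiv.swap 0 1, by simpa using h1, by simpa using h0⟩
  set s : Fin 2 → ℝ := ![(Real.sqrt (hJ₁c.eigenvalues (perm 0)))⁻¹, (Real.sqrt (-hJ₁c.eigenvalues (perm 1)))⁻¹] with hs
  set Tm : Matrix (Fin 2) (Fin 2) ℂ :=
    (hJ₁c.eigenvectorUnitary : Matrix (Fin 2) (Fin 2) ℂ).submatrix id perm * Matrix.diagonal (fun k => (s k : ℂ))
    with hTm
  have hpos' : (Real.sqrt (hJ₁c.eigenvalues (perm 0)))⁻¹ * hJ₁c.eigenvalues (perm 0) *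
      (Real.sqrt (hJ₁c.eigenvalues (perm 0)))⁻¹ = 1 := by
    rw [mul_comm ((Real.sqrt _)⁻¹) (hJ₁c.eigenvalues (perm 0)), mul_assoc, ← mul_inv,
      Real.mul_self_sqrt hp0.le, mul_inv_cancel₀ hp0.ne']
  have hneg' : (Real.sqrt (-hJ₁c.eigenvalues (perm 1)))⁻¹ * hJ₁c.eigenvalues (perm 1) *
      (Real.sqrt (-hJ₁c.eigenvalues (perm 1)))⁻¹ = -1 := by
    rw [mul_comm ((Real.sqrt _)⁻¹) (hJ₁c.eigenvalues (perm 1)), mul_assoc, ← mul_inv,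
      Real.mul_self_sqrt (neg_pos.2 hp1).le, inv_neg, mul_neg, mul_inv_cancel₀ hp1.ne]
  have hTm' : Tmᴴ * J₁c * Tm = Matrix.diagonal ![1, -1] := by
    rw [hTm, conjTranspose_mul_mul_submatrix_mul_diagonal J₁c _ hU perm s]
    congr 1
    funext k
    fin_cases k
    · simp only [Fin.zero_eta, hs, Function.comp_apply, Matrix.cons_val_zero, hcoe]
      exact_mod_cast hpos'
    · simp only [Fin.mk_one, hs, Function.comp_apply, Matrix.cons_val_one, Matrix.cons_val_zero, hcoe]
      exact_mod_cast hneg'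
  have hdet : Tm.det ≠ 0 := by
    intro h0
    have h := congrArg Matrix.det hTm'
    rw [Matrix.det_mul, Matrix.det_mul, h0, mul_zero, Matrix.det_diagonal] at h
    simp [Fin.prod_univ_two] at h
  exact ⟨Matrix.GeneralLinearGroup.mkOfDetNeZero Tm hdet, hTm'⟩

end Signature

/-! ## §6 The `E`-rational form at `(N₁, N₂) = (2, 1)`: GS-3's signature hypothesis from the face's data -/

section RationalSignature

variable {E : Type*} [Field E] (σ : E →+* E) (τ : E →+* ℂ)

/-- **Signature `(1,1)` of `J⋆^τ` from a frame of the face.**  Let `σ` be an involution of the field `E` and `τ : E →+* ℂ` an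
embedding with `τ ∘ σ = conj ∘ τ`; let `H ∈ M₃(E)` be `σ`-hermitian with a Sylvester frame of signature `(2,1)` at `τ`
(`ᵗconj(T)·H^τ·T = diag(1,1,−1)`), `a` a `σ`-fixed scalar with `τ a` a positive real, and `ᵗσ(B)·(a • H)·B = J⋆ ⊕ᶠ J⊥` a frame
with `Re τ(J⊥₀₀) > 0` (★ `exists_frame_formCongr_eq_finSum_of_isTotallyPositive`'s `hpos`).  Then `J⋆^τ` has a Sylvester frame
of signature `(1,1)`: `∃ T⋆ ∈ GL₂(ℂ), ᵗconj(T⋆)·J⋆^τ·T⋆ = diag(1,−1)` — literally the `_hT` hypothesis of the cell's GS-3 text for the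
special unitary Shimura curve of `V⋆ = W^⊥`. [cite: HornJohnson2013, §4.5 Thm 4.5.8 (Sylvester's law of inertia)]
[cite: BergeronMillsonMoeglin2016Balls, Part 2 §3.1] -/
theorem exists_frame_map_subform_left_eq_diagonal (hσ : ∀ x, σ (σ x) = x)
    (hτ : ∀ x, τ (σ x) = starRingEnd ℂ (τ x)) {H : Matrix (Fin 3) (Fin 3) E} (hH : (H.map σ)ᵀ = H) {T : GL (Fin 3) ℂ}
    (hT : formCongr (starRingEnd ℂ) T (H.map τ) = Matrix.diagonal ![1, 1, -1]) {a : E} (haσ : σ a = a)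
    (ha : 0 < (τ a).re) (ha' : (τ a).im = 0) {B : GL (Fin 3) E} {Jstar : Matrix (Fin 2) (Fin 2) E}
    {Jperp : Matrix (Fin 1) (Fin 1) E} (hB : formCongr σ B (a • H) = finSum 2 1 Jstar Jperp)
    (hpos : 0 < (τ (Jperp 0 0)).re) :
    ∃ Tstar : GL (Fin 2) ℂ, formCongr (starRingEnd ℂ) Tstar (Jstar.map τ) = Matrix.diagonal ![1, -1] := by
  have hBc := formCongr_map_eq_finSum_map (N₁ := 2) (N₂ := 1) τ hτ hB
  have hJ₁ : (Jstar.map σ)ᵀ = Jstar := isHermitian_subform_left (N₁ := 2) (N₂ := 1) σ hσ hH haσ hB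
  have hJ₂ : (Jperp.map σ)ᵀ = Jperp := isHermitian_subform_right (N₁ := 2) (N₂ := 1) σ hσ hH haσ hB
  have hJ₁c : (Jstar.map τ).IsHermitian := isHermitian_map_of_transpose_map_eq σ τ hτ hJ₁
  have hperp_im : ((Jperp.map τ) 0 0).im = 0 := by
    rw [Matrix.map_apply]
    refine Literature.LinearAlgebra.Matrix.im_eq_zero_of_fixed τ σ hτ ?_
    have h := congrFun (congrFun hJ₂ 0) 0
    rwa [transpose_apply, map_apply] at h
  have hperp_re : 0 < ((Jperp.map τ) 0 0).re := by rw [Matrix.map_apply]; exact hpos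
  exact exists_frame_formCongr_eq_diagonal_one_neg_one hT ha ha' hJ₁c hperp_re hperp_im hBc

/-- The case `a = 1` (the face's frame `ᵗσ(B)·((1 : E) • H)·B = J⋆ ⊕ᶠ J⊥`, ★ `FacePinData.hB`):
`∃ T⋆ ∈ GL₂(ℂ), ᵗconj(T⋆)·J⋆^τ·T⋆ = diag(1,−1)`. [cite: HornJohnson2013, §4.5 Thm 4.5.8 (Sylvester's law of inertia)]
[cite: BergeronMillsonMoeglin2016Balls, Part 2 §3.1] -/
theorem exists_frame_map_subform_left_eq_diagonal_one (hσ : ∀ x, σ (σ x) = x)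
    (hτ : ∀ x, τ (σ x) = starRingEnd ℂ (τ x)) {H : Matrix (Fin 3) (Fin 3) E} (hH : (H.map σ)ᵀ = H) {T : GL (Fin 3) ℂ}
    (hT : formCongr (starRingEnd ℂ) T (H.map τ) = Matrix.diagonal ![1, 1, -1]) {B : GL (Fin 3) E}
    {Jstar : Matrix (Fin 2) (Fin 2) E} {Jperp : Matrix (Fin 1) (Fin 1) E}
    (hB : formCongr σ B ((1 : E) • H) = finSum 2 1 Jstar Jperp) (hpos : 0 < (τ (Jperp 0 0)).re) :
    ∃ Tstar : GL (Fin 2) ℂ, formCongr (starRingEnd ℂ) Tstar (Jstar.map τ) = Matrix.diagonal ![1, -1] :=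
  exists_frame_map_subform_left_eq_diagonal σ τ hσ hτ hH hT (map_one σ) (by rw [map_one, Complex.one_re]; exact one_pos)
    (by rw [map_one, Complex.one_im]) hB hpos

end RationalSignature

end Literature.NumberTheory.Automorphic.UnitaryGroup

end
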